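import Summits.BirchSwinnertonDyer.BirchSwinnertonDyer.Theorems.ManinLocalTwoThreeTwoAdicDegeneracyUnitTwist
import Summits.BirchSwinnertonDyer.Rank1Residual.ManinAdditive.KatoCurvePlusDefectProofs
import HarnessLib

/-!
# THEOREM U at `p = 2` read at KATO'S CURVE: the ratio-`8` degeneracy polar witness transported along `Ω(W) ∣₂ Ω(E_K)` (E-es-63),
# and `2 ∤ c(W)` at squarefull `4 ∣ N` with NO PLUS DEFECT at `2`, reducible `W[2]` allowed, modulo F-es-21♭K (+ E-es-68₈)

Summit `BirchSwinnertonDyer`, route `ManinLocalTwoThree` (cell bsd-f2-manin), crux C2 `ManinOddAtFour` (stmt-BirchSwinnertonDyer-22967).  The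
`p = 2` twin of `…DegeneracyUnitTwistKatoCurve`: on the `W[2]`-REDUCIBLE locus (rational `2`-torsion) Kato's fact is available only at
Kato's own curve `E_K` (`IsSymbolClosureCurve VK D.f`, Literature fact F-es-21♭K `kato_isIntegral_twistedSymbolSum_two_symbolClosure`);
the tree's one-sided transfer `twoAdicPolarWitness_of_periodDividesAt` and es's THEOREM E-es-63 `katoCurvePeriodDvdOfNoPlusDefect_holds`
(`p`-uniform, here `p = 2`, on the locus `CuspidalPlusDefectPrimeTo 2 D`) carry this seat's class-blind witness
`twoAdicPolarWitness_of_degeneracyEightPlusIndex` over to `E_K`: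

* `twoAdicPolarWitness_katoCurve_of_degeneracyEightPlusIndex` — `TwoAdicPolarWitness W VK D.f`;
* `not_two_dvd_maninConstant_of_degeneracyEightPlusIndex_symbolClosure` / `…_of_degeneracyLoopLawEight_symbolClosure` (+ composite
  squarefull variant `'`) — **`2 ∤ D.c`** for every lattice-optimal datum of a globally minimal `W` at a squarefull level `4 ∣ N` with no
  plus defect at `2`, modulo F-es-21♭K and the f-specific odd ratio-`8` index (resp. the lattice law E-es-68₈ + `PlusIndexPrimeTo 2`).
Compared with the C2 road `not_two_dvd_maninConstant_of_noRationalTwoTorsion` (TURNKEY-an-15: Kato facts + E-es-66₂ + E-an-128₂ + no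
rational `2`-torsion), on the squarefull locus the law E-es-66₂ is REPLACED by E-es-68₈ (or the f-specific index) and no torsion hypothesis
is used.

HONEST FRAMING: CONDITIONAL (F-es-21♭K a Literature `def`; E-es-68₈ a typed law; `VK` a binder).  C2, Manin's conjecture and BSD are NOT
proved by this.  No definitions, no named facts, no sorry.
-/

set_option linter.dupNamespace false
set_option autoImplicit false

noncomputable section

open scoped Classical MatrixGroups ModularForm ComplexConjugate

open CongruenceSubgroup Complex Literature.NumberTheory.EllipticCurves
  Literature.NumberTheory.EllipticCurves.ModularForms
  Summit.BirchSwinnertonDyer.Rank1Residual.ManinAdditive.Gamma1Lattice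
  Summit.BirchSwinnertonDyer.Rank1Residual.ManinAdditive.KatoCurve

namespace Summit.BirchSwinnertonDyer.BirchSwinnertonDyer.Theorems.ManinLocalTwoThree

/-- **THEOREM U at `p = 2` read at Kato's curve**: the ratio-`8` degeneracy polar witness of `W` transported along `Ω(W) ∣₂ Ω(E_K)`
(E-es-63 on the no-plus-defect locus): `TwoAdicPolarWitness W VK D.f`. -/
theorem twoAdicPolarWitness_katoCurve_of_degeneracyEightPlusIndex
    (W : WeierstrassCurve ℚ) [W.IsElliptic] [W.IsGloballyMinimal] {N : ℕ} [NeZero N] (D : ModularParametrizationData W N)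
    (hopt : ∀ z ∈ D.L.lattice, ∃ w ∈ periodLattice D.f, z = D.c * w)
    (h4 : 2 ^ 2 ∣ N) (hsq : ∀ ℓ ∈ N.primeFactors, ℓ ^ 2 ∣ N)
    (hd : ∀ x ∈ periodLattice D.f, ∃ y ∈ AddSubgroup.closure (degeneracyLoops D.f 8), ∃ k : ℕ, ¬ 2 ∣ k ∧
      (k : ℂ) * (x + conj x) = y + conj y)
    (hpd : CuspidalPlusDefectPrimeTo 2 D)
    (VK : WeierstrassCurve ℚ) [VK.IsElliptic] [VK.IsGloballyMinimal] (hiso : WeierstrassCurve.IsIsogenous W VK)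
    (hK : IsSymbolClosureCurve VK D.f) (hnewK : IsNewformOf VK D.f) (hgK : ¬ VK.HasGoodReductionAtPrime 2)
    (hmK : ¬ VK.HasMultiplicativeReductionAtPrime 2) (haK : ∀ ℓ : ℕ, VK.LFunction ℓ = W.LFunction ℓ) :
    TwoAdicPolarWitness W VK D.f :=
  twoAdicPolarWitness_of_periodDividesAt W VK W D.f
    (twoAdicPolarWitness_of_degeneracyEightPlusIndex W D h4 hsq hd)
    (katoCurvePeriodDvdOfNoPlusDefect_holds 2 W D hopt hpd VK hiso hK) hnewK hgK hmK haK

/-- **`2 ∤ c(W)` at squarefull `4 ∣ N` with NO PLUS DEFECT at `2`, reducible `W[2]` allowed**, modulo F-es-21♭K, from the f-specific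
odd ratio-`8` degeneracy plus index. CONDITIONAL. [cite: Kato2004Asterisque, Thm. 12.5 (1) (p. 221)] -/
theorem not_two_dvd_maninConstant_of_degeneracyEightPlusIndex_symbolClosure
    (hF : kato_isIntegral_twistedSymbolSum_two_symbolClosure)
    (W : WeierstrassCurve ℚ) [W.IsElliptic] [W.IsGloballyMinimal] {N : ℕ} [NeZero N] (D : ModularParametrizationData W N)
    (hopt : ∀ z ∈ D.L.lattice, ∃ w ∈ periodLattice D.f, z = D.c * w)
    (h4 : 2 ^ 2 ∣ N) (hsq : ∀ ℓ ∈ N.primeFactors, ℓ ^ 2 ∣ N)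
    (hd : ∀ x ∈ periodLattice D.f, ∃ y ∈ AddSubgroup.closure (degeneracyLoops D.f 8), ∃ k : ℕ, ¬ 2 ∣ k ∧
      (k : ℂ) * (x + conj x) = y + conj y)
    (hpd : CuspidalPlusDefectPrimeTo 2 D)
    (VK : WeierstrassCurve ℚ) [VK.IsElliptic] [VK.IsGloballyMinimal] (hiso : WeierstrassCurve.IsIsogenous W VK)
    (hK : IsSymbolClosureCurve VK D.f) (hnewK : IsNewformOf VK D.f) (hgK : ¬ VK.HasGoodReductionAtPrime 2)
    (hmK : ¬ VK.HasMultiplicativeReductionAtPrime 2) (haK : ∀ ℓ : ℕ, VK.LFunction ℓ = W.LFunction ℓ) :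
    ¬ (2 : ℤ) ∣ D.c := by
  have hwit : TwoAdicPolarWitness W VK D.f :=
    twoAdicPolarWitness_katoCurve_of_degeneracyEightPlusIndex W D hopt h4 hsq hd hpd VK hiso hK hnewK hgK hmK haK
  have hFact : KatoFactTwoAt VK D.f := hF VK D.f hK
  have hΩ : W.realPeriodRat = ((|D.c| : ℤ) : ℝ) * plusPeriod D.f := by
    rw [Int.cast_abs]; exact D.realPeriodRat_eq_abs_mul_plusPeriod_of_latticeEq hopt
  have hc0 : D.c ≠ 0 := D.maninConstant_ne_zero_holds
  have h := not_two_dvd_of_katoFactTwoAt_of_witness W VK D.f |D.c| hFact hwit hΩ (abs_ne_zero.mpr hc0)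
  exact fun h2 ↦ h ((dvd_abs 2 D.c).mpr h2)

/-- **The same from the lattice law E-es-68₈ and `PlusIndexPrimeTo 2 D.f`**. CONDITIONAL. [cite: Kato2004Asterisque, Thm. 12.5 (1) (p. 221)] -/
theorem not_two_dvd_maninConstant_of_degeneracyLoopLawEight_symbolClosure (h68 : DegeneracyLoopLawEight)
    (hF : kato_isIntegral_twistedSymbolSum_two_symbolClosure)
    (W : WeierstrassCurve ℚ) [W.IsElliptic] [W.IsGloballyMinimal] {N : ℕ} [NeZero N] (D : ModularParametrizationData W N)
    (hopt : ∀ z ∈ D.L.lattice, ∃ w ∈ periodLattice D.f, z = D.c * w)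
    (h4 : 2 ^ 2 ∣ N) (hsq : ∀ ℓ ∈ N.primeFactors, ℓ ^ 2 ∣ N) (hpi : PlusIndexPrimeTo 2 D.f)
    (hpd : CuspidalPlusDefectPrimeTo 2 D)
    (VK : WeierstrassCurve ℚ) [VK.IsElliptic] [VK.IsGloballyMinimal] (hiso : WeierstrassCurve.IsIsogenous W VK)
    (hK : IsSymbolClosureCurve VK D.f) (hnewK : IsNewformOf VK D.f) (hgK : ¬ VK.HasGoodReductionAtPrime 2)
    (hmK : ¬ VK.HasMultiplicativeReductionAtPrime 2) (haK : ∀ ℓ : ℕ, VK.LFunction ℓ = W.LFunction ℓ) :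
    ¬ (2 : ℤ) ∣ D.c :=
  not_two_dvd_maninConstant_of_degeneracyEightPlusIndex_symbolClosure hF W D hopt h4 hsq
    (fun x hx ↦ by
      obtain ⟨y, hy, k, hk, hxy⟩ := hpi x hx
      exact ⟨y, by rw [h68 h4 D.f]; exact hy, k, hk, hxy⟩)
    hpd VK hiso hK hnewK hgK hmK haK

/-- **Composite squarefull variant**: an odd prime `q` with `q² ∣ N` discharges `PlusIndexPrimeTo 2` (Hecke sieve). CONDITIONAL on
F-es-21♭K + E-es-68₈. [cite: Kato2004Asterisque, Thm. 12.5 (1) (p. 221)] -/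
theorem not_two_dvd_maninConstant_of_degeneracyLoopLawEight_symbolClosure' (h68 : DegeneracyLoopLawEight)
    (hF : kato_isIntegral_twistedSymbolSum_two_symbolClosure)
    (W : WeierstrassCurve ℚ) [W.IsElliptic] [W.IsGloballyMinimal] {N : ℕ} [NeZero N] (D : ModularParametrizationData W N)
    (hopt : ∀ z ∈ D.L.lattice, ∃ w ∈ periodLattice D.f, z = D.c * w)
    (h4 : 2 ^ 2 ∣ N) (hsq : ∀ ℓ ∈ N.primeFactors, ℓ ^ 2 ∣ N) {q : ℕ} (hq : q.Prime) (hq2 : q ≠ 2) (hqN : q ^ 2 ∣ N)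
    (hpd : CuspidalPlusDefectPrimeTo 2 D)
    (VK : WeierstrassCurve ℚ) [VK.IsElliptic] [VK.IsGloballyMinimal] (hiso : WeierstrassCurve.IsIsogenous W VK)
    (hK : IsSymbolClosureCurve VK D.f) (hnewK : IsNewformOf VK D.f) (hgK : ¬ VK.HasGoodReductionAtPrime 2)
    (hmK : ¬ VK.HasMultiplicativeReductionAtPrime 2) (haK : ∀ ℓ : ℕ, VK.LFunction ℓ = W.LFunction ℓ) :
    ¬ (2 : ℤ) ∣ D.c :=
  not_two_dvd_maninConstant_of_degeneracyLoopLawEight_symbolClosure h68 hF W D hopt h4 hsq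
    (plusIndexPrimeTo_of_sq_dvd D.isNewformOf.1 hq hqN
      fun h ↦ hq2 ((Nat.prime_dvd_prime_iff_eq Nat.prime_two hq).mp h).symm)
    hpd VK hiso hK hnewK hgK hmK haK

end Summit.BirchSwinnertonDyer.BirchSwinnertonDyer.Theorems.ManinLocalTwoThree

end
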